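import Literature.NumberTheory.GaloisRepresentations.RestrictedRamificationInflationKernel
import Literature.NumberTheory.GaloisRepresentations.RestrictedRamificationKummer
import HarnessLib

/-!
# `ker(inf²)` dies under `μ_{p^a} ↪ μ_{p^{a+t}}` — the consumer-ready `p`-power form, with Kummer
# theory over `K_S` and «`N_S` fixes `μ_{p^∞}`» discharged by name

Sequel to `RestrictedRamificationInflationKernel.lean` (same setting: `S` finite places of the number
field `K`, `N_S = ramificationSubgroup K S`, `H ≤ Γ_K` closed with `N_S ≤ H`, `F := K̄^H ⊆ K_S`,
`q : H ↠ galoisGroupAbove S H = Gal(K_S/F)`, a descended action `ρG` of `Gal(K_S/F)` on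
`μ_N = MuCarrier K N`, a continuous `2`-cocycle `f` of `Gal(K_S/F)` in `μ_N` with `f ∘ (q × q) = ∂φ` on
`H`).  That file proves «`J_*[f] = 0` in `H²(Gal(K_S/F), μ_{N'})`» from the two binders (RD) (radical
descent at a UNIFORM exponent pair `N·e = N'`) and (KUM) (Kummer theory for `1`-cocycles `N_S → μ_N`).
Here the argument is cut into its two reusable halves and re-assembled in the shape the finite-stage
killing statement of the cyclotomic weak Leopoldt assembly consumes:

* §1 `exists_transgression_kummerGenerator` — from (KUM): a unit `β` of `K̄` with
  `x(n) = φ(n) − f(1,1) = n(β)/β` on `N_S`, `b := β^N ∈ K_S^×` (`N_S`-fixed) and the `H`-KUMMER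
  CONDITION `σ(b) = b · d_σ^N`, `d_σ ∈ K_S^×`, for `σ ∈ H` (from the `Γ`-equivariance of the
  transgression datum); `exists_transgression_kummerGenerator_of_numberField` — the same with (KUM)
  DISCHARGED by the tree's `ramificationSubgroup.exists_kummer_eq_contOneCocycle`
  (`RestrictedRamificationKummer.lean`);
* §2 `cohomologyMap_twoCocycleClass_eq_zero_of_kummerGenerator` /
  `exists_twoCoboundary_of_kummerGenerator'` — from such a `β` and ANY factorisation
  `(β^N)^e = c · d^{N'}` with `c ∈ F^×`, `d ∈ K_S^×`, `N·e = N'`: `J_*[f] = 0`, resp. (self-contained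
  coefficients, `N_S` fixing `μ_{N'}`) `ι ∘ f = ∂b` for a continuous `b : Gal(K_S/F) → μ_{N'}`;
* §3 **`exists_twoCoboundary_of_radicalDescent_primePow`** — `K` a number field, `S ⊇ {v ∣ p}`,
  `N = p^a`: GIVEN (RD) in the per-element form «`b ∈ K_S`, `b ≠ 0`, `σ(b) ∈ b·(K_S)^{p^a}` for all
  `σ ∈ H` ⟹ `∃ t, b^{p^t} = c · d^{p^{a+t}}`, `c ∈ F^×`, `d ∈ K_S`» (elements of `K̄`, the exponent `t`
  may depend on `b`), THEN `∃ t` and a continuous `b : Gal(K_S/F) → μ_{p^{a+t}}` with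
  `ι(f(q σ, q τ)) = σ·b(q τ) − b(q(στ)) + b(q σ)` for all `σ, τ ∈ H`; (KUM) and «`N_S` fixes
  `μ_{p^{a+t}}`» (tree `smul_units_eq_self_of_mem_ramificationSubgroup`, `RestrictedRamificationKummer.lean`;
  also `smul_eq_self_of_mem_ramificationSubgroup_of_pow_eq_one`, `UnramifiedRadicalDescentAbsolute.lean`)
  are discharged, so (RD) is the ONLY remaining input — for
  `H` OPEN it is the finiteness of the class group of the number field `F` read through Kummer theory
  (Neukirch–Schmidt–Wingberg (8.3.11) (ii)).

USE: at an open stage `H = U₀ ∩ Gal(K̄/K(μ_{p^k}))` of the cyclotomic tower, after the Brauer-killing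
step has made `f ∘ (q × q)` a coboundary, §3 produces the `μ_{p^{a+t}}`-valued coboundary; at any
deeper stage fixing `μ_{p^{a+t}}` the action in `∂b` is trivial — the cochain-level killing the tree's
`subsingleton_H2_trivial_iInf_of_forall_exists` / the «stagesDie» interface of
`WeakLeopoldtCyclotomicLevels` ask for.  HONEST FRAMING: Galois-cohomological plumbing towards the
weak Leopoldt statement for the cyclotomic `ℤ_p`-extension (NSW (10.3.25)); (RD) is a hypothesis;
no conjecture is proved here.

## References

* J. Neukirch, A. Schmidt, K. Wingberg, *Cohomology of Number Fields*, 2nd ed. (2008), (1.6.7),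
  (8.3.11) (ii), (10.3.25). [NeukirchSchmidtWingberg2008]
* J.-P. Serre, *Local Fields* (1979), X §3 (b). [Serre1979]
* K. Iwasawa, *On ℤ_ℓ-extensions of algebraic number fields*, Ann. of Math. 98 (1973) 246–326, §2.
-/

noncomputable section

open CategoryTheory Function Topology Field NumberField IsDedekindDomain

namespace Literature.NumberTheory.GaloisRepresentations

open _root_.TopRep _root_.ContRepresentation _root_.ContinuousCohomology DiscreteGaloisModule
open Literature.NumberTheory.IwasawaTheory.Greenberg2006

variable {K : Type} [Field K] [NumberField K] (S : Set (HeightOneSpectrum (𝓞 K)))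
  (H : Subgroup (absoluteGaloisGroup K))

/-! ### §1. The Kummer generator of the transgression datum -/

omit [NumberField K] in
/-- **The Kummer generator `β` of the transgression datum.**  For a `2`-cocycle `f` of `Gal(K_S/F)` in
`μ_N` (descended action `ρG`) with `f ∘ (q × q) = ∂φ` on `H ⊇ N_S`, (KUM) yields a unit `β` of `K̄` with
`φ(n) − f(1,1) = n(β)/β` for `n ∈ N_S`; then `b := β^N` is `N_S`-fixed and, by the `Γ`-equivariance of
the transgression datum (`transgression_conj`), satisfies the `H`-Kummer condition
`σ(b) = b · d^N` with `d = σ(β)/β ∈ K_S^×` for every `σ ∈ H`.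
[cite: NeukirchSchmidtWingberg2008, (1.6.7), (8.3.11) (ii)] [cite: Serre1979, Ch. X §3 b)] -/
theorem exists_transgression_kummerGenerator (hNH : ramificationSubgroup K S ≤ H) {N : ℕ}
    (hKUM : ∀ x : contOneCocycles ((mu K N).restrict (subgroupIncl (ramificationSubgroup K S))).toTopRep,
      ∃ β : (AlgebraicClosure K)ˣ, ∀ n : ramificationSubgroup K S,
        muVal K N (x.1 n) = (n : absoluteGaloisGroup K) • β / β)
    (ρG : ContinuousRep (galoisGroupAbove S H) ℤ (MuCarrier K N))
    (hρG : ∀ (σ : H) (v : MuCarrier K N),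
      ρG ⟨toUnramifiedQuot K S (σ : absoluteGaloisGroup K), coe_mem_galoisGroupAbove S H σ⟩ v =
        mu K N (σ : absoluteGaloisGroup K) v)
    (f : contTwoCocycles ρG.toTopRep) (φ : C(H, MuCarrier K N))
    (hφ : ∀ σ τ : H,
      f.1 (⟨toUnramifiedQuot K S (σ : absoluteGaloisGroup K), coe_mem_galoisGroupAbove S H σ⟩,
          ⟨toUnramifiedQuot K S (τ : absoluteGaloisGroup K), coe_mem_galoisGroupAbove S H τ⟩) =
        mu K N (σ : absoluteGaloisGroup K) (φ τ) - φ (σ * τ) + φ σ) :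
    ∃ β : (AlgebraicClosure K)ˣ,
      (∀ (n : absoluteGaloisGroup K) (hn : n ∈ ramificationSubgroup K S),
        muVal K N (φ ⟨n, hNH hn⟩ - f.1 (1, 1)) = n • β / β) ∧
      (∀ n ∈ ramificationSubgroup K S, n • β ^ N = β ^ N) ∧
      ∀ σ ∈ H, ∃ d : (AlgebraicClosure K)ˣ,
        (∀ n ∈ ramificationSubgroup K S, n • d = d) ∧ σ • β ^ N = β ^ N * d ^ N := by
  -- the quotient map `θ = q : H ↠ Gal(K_S/F)`
  let θ : H →ₜ* galoisGroupAbove S H :=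
    { toFun := fun σ => ⟨toUnramifiedQuot K S (σ : absoluteGaloisGroup K), coe_mem_galoisGroupAbove S H σ⟩
      map_one' := Subtype.ext (by simp)
      map_mul' := fun a b => galoisGroupAbove_mk_mul S H a b
      continuous_toFun := ((continuous_toUnramifiedQuot K S).comp continuous_subtype_val).subtype_mk _ }
  have hθ : ∀ σ : H, θ σ = ⟨toUnramifiedQuot K S (σ : absoluteGaloisGroup K), coe_mem_galoisGroupAbove S H σ⟩ :=
    fun _ => rfl
  have hθN : ∀ {n : H}, θ n = 1 ↔ (n : absoluteGaloisGroup K) ∈ ramificationSubgroup K S := fun {n} =>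
    galoisGroupAbove_mk_eq_one_iff S H n
  have hφ' : ∀ σ τ : H, f.1 (θ σ, θ τ) = ρG.toTopRep.ρ (θ σ) (φ τ) - φ (σ * τ) + φ σ := fun σ τ => by
    rw [ContinuousRep.toTopRep_ρ_apply, hθ, hρG]
    exact hφ σ τ
  -- the transgression datum and its Kummer generator
  obtain ⟨x, hx⟩ := exists_transgression_oneCocycle S H hNH ρG hρG f φ hφ
  obtain ⟨β, hβ⟩ := hKUM x
  have hβ' : ∀ (n : absoluteGaloisGroup K) (hn : n ∈ ramificationSubgroup K S),
      muVal K N (φ ⟨n, hNH hn⟩ - f.1 (1, 1)) = n • β / β := fun n hn => by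
    rw [← hx ⟨n, hn⟩]; exact hβ ⟨n, hn⟩
  have hnβ : ∀ (n : absoluteGaloisGroup K) (hn : n ∈ ramificationSubgroup K S),
      n • β = muVal K N (φ ⟨n, hNH hn⟩ - f.1 (1, 1)) * β := fun n hn =>
    (eq_div_iff_mul_eq'.mp (hβ' n hn)).symm
  refine ⟨β, hβ', fun n hn => ?_, fun σ hσ => ?_⟩
  · rw [smul_pow', hnβ n hn, mul_pow, muVal_pow_eq_one, one_mul]
  · -- equivariance: `σ • x(σ⁻¹ n σ) = x(n)`
    have hequiv : ∀ (n : absoluteGaloisGroup K) (hn : n ∈ ramificationSubgroup K S)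
        (hn₁ : σ⁻¹ * n * σ ∈ ramificationSubgroup K S),
        σ • muVal K N (φ ⟨σ⁻¹ * n * σ, hNH hn₁⟩ - f.1 (1, 1)) = muVal K N (φ ⟨n, hNH hn⟩ - f.1 (1, 1)) := by
      intro n hn hn₁
      have h := transgression_conj θ f φ hφ' ⟨σ, hσ⟩ (hθN.2 hn₁ : θ ⟨σ⁻¹ * n * σ, hNH hn₁⟩ = 1)
      rw [ContinuousRep.toTopRep_ρ_apply, hθ, hρG] at h
      have hconj : (⟨σ, hσ⟩ : H) * (⟨σ⁻¹ * n * σ, hNH hn₁⟩ : H) * (⟨σ, hσ⟩ : H)⁻¹ = ⟨n, hNH hn⟩ :=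
        Subtype.ext (by simp [mul_assoc])
      rw [hconj] at h
      rw [← muVal_apply, ← h]
    refine ⟨σ • β / β, fun n hn => ?_, ?_⟩
    · have hn₁ : σ⁻¹ * n * σ ∈ ramificationSubgroup K S := by
        simpa using Subgroup.Normal.conj_mem inferInstance n hn σ⁻¹
      have h1 : n • σ • β = muVal K N (φ ⟨n, hNH hn⟩ - f.1 (1, 1)) * σ • β := by
        rw [← mul_smul, show n * σ = σ * (σ⁻¹ * n * σ) by simp [mul_assoc], mul_smul, hnβ _ hn₁, smul_mul',
          hequiv n hn hn₁]
      rw [smul_div', h1, hnβ n hn, mul_div_mul_left_eq_div]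
    · rw [smul_pow', ← mul_pow, mul_div_cancel]

/-- **The Kummer generator, (KUM) discharged** (`K` a number field, any `N`): the tree's Kummer theory on
`N_S = Gal(K̄/K_S)` (`ramificationSubgroup.exists_kummer_eq_contOneCocycle`, Hilbert 90 for the closed
subgroup `N_S`) supplies the binder. [cite: Serre1979, Ch. X §3 b)] [cite: NeukirchSchmidtWingberg2008, (8.3.11) (ii)] -/
theorem exists_transgression_kummerGenerator_of_numberField (hNH : ramificationSubgroup K S ≤ H) {N : ℕ}
    [NeZero N] (ρG : ContinuousRep (galoisGroupAbove S H) ℤ (MuCarrier K N))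
    (hρG : ∀ (σ : H) (v : MuCarrier K N),
      ρG ⟨toUnramifiedQuot K S (σ : absoluteGaloisGroup K), coe_mem_galoisGroupAbove S H σ⟩ v =
        mu K N (σ : absoluteGaloisGroup K) v)
    (f : contTwoCocycles ρG.toTopRep) (φ : C(H, MuCarrier K N))
    (hφ : ∀ σ τ : H,
      f.1 (⟨toUnramifiedQuot K S (σ : absoluteGaloisGroup K), coe_mem_galoisGroupAbove S H σ⟩,
          ⟨toUnramifiedQuot K S (τ : absoluteGaloisGroup K), coe_mem_galoisGroupAbove S H τ⟩) =
        mu K N (σ : absoluteGaloisGroup K) (φ τ) - φ (σ * τ) + φ σ) :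
    ∃ β : (AlgebraicClosure K)ˣ,
      (∀ (n : absoluteGaloisGroup K) (hn : n ∈ ramificationSubgroup K S),
        muVal K N (φ ⟨n, hNH hn⟩ - f.1 (1, 1)) = n • β / β) ∧
      (∀ n ∈ ramificationSubgroup K S, n • β ^ N = β ^ N) ∧
      ∀ σ ∈ H, ∃ d : (AlgebraicClosure K)ˣ,
        (∀ n ∈ ramificationSubgroup K S, n • d = d) ∧ σ • β ^ N = β ^ N * d ^ N :=
  exists_transgression_kummerGenerator S H hNH
    (fun x => by
      obtain ⟨β, -, h⟩ := ramificationSubgroup.exists_kummer_eq_contOneCocycle K S N x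
      exact ⟨β, h⟩)
    ρG hρG f φ hφ

/-! ### §2. From the Kummer generator and a radical factorisation to the coboundary -/

/-- **`J_*[f] = 0` from a Kummer generator `β` and a factorisation `(β^N)^e = c·d^{N'}`** (`c ∈ F^×`,
`d ∈ K_S^×`, `N·e = N'`): the Kummer cocycle `σ ↦ σ(δ)/δ` of `δ = β/d` (an `N'`-th root of `c`) on `H`
restricts to `ι ∘ x` on `N_S`, so the abstract lemma
`cohomologyMap_twoCocycleClass_eq_zero_of_oneCocycle_extension` applies.
[cite: NeukirchSchmidtWingberg2008, (1.6.7), (8.3.11) (ii)] [cite: Serre1979, Ch. X §3 b)] -/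
theorem cohomologyMap_twoCocycleClass_eq_zero_of_kummerGenerator
    (hH : IsClosed (H : Set (absoluteGaloisGroup K))) (hNH : ramificationSubgroup K S ≤ H)
    {N N' e : ℕ} (hNe : N * e = N')
    (ρG : ContinuousRep (galoisGroupAbove S H) ℤ (MuCarrier K N))
    (hρG : ∀ (σ : H) (v : MuCarrier K N),
      ρG ⟨toUnramifiedQuot K S (σ : absoluteGaloisGroup K), coe_mem_galoisGroupAbove S H σ⟩ v =
        mu K N (σ : absoluteGaloisGroup K) v)
    (ρG' : ContinuousRep (galoisGroupAbove S H) ℤ (MuCarrier K N'))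
    (hρG' : ∀ (σ : H) (v : MuCarrier K N'),
      ρG' ⟨toUnramifiedQuot K S (σ : absoluteGaloisGroup K), coe_mem_galoisGroupAbove S H σ⟩ v =
        mu K N' (σ : absoluteGaloisGroup K) v)
    (J : ρG.toTopRep ⟶ ρG'.toTopRep) (hJ : ∀ v : MuCarrier K N, J.hom v = muInclusion K ⟨e, hNe.symm⟩ v)
    (f : contTwoCocycles ρG.toTopRep) (φ : C(H, MuCarrier K N))
    (hφ : ∀ σ τ : H,
      f.1 (⟨toUnramifiedQuot K S (σ : absoluteGaloisGroup K), coe_mem_galoisGroupAbove S H σ⟩,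
          ⟨toUnramifiedQuot K S (τ : absoluteGaloisGroup K), coe_mem_galoisGroupAbove S H τ⟩) =
        mu K N (σ : absoluteGaloisGroup K) (φ τ) - φ (σ * τ) + φ σ)
    (β : (AlgebraicClosure K)ˣ)
    (hβ : ∀ (n : absoluteGaloisGroup K) (hn : n ∈ ramificationSubgroup K S),
      muVal K N (φ ⟨n, hNH hn⟩ - f.1 (1, 1)) = n • β / β)
    (c d : (AlgebraicClosure K)ˣ) (hc : ∀ σ ∈ H, σ • c = c) (hd : ∀ n ∈ ramificationSubgroup K S, n • d = d)
    (hbe : (β ^ N) ^ e = c * d ^ N') :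
    haveI : CompactSpace (galoisGroupAbove S H) := compactSpace_galoisGroupAbove S H hH
    cohomologyMap J 2 (twoCocycleClass _ f) = 0 := by
  haveI : CompactSpace (absoluteGaloisGroup K) := absoluteGaloisGroup_compactSpace K
  haveI : CompactSpace H := isCompact_iff_compactSpace.mp hH.isCompact
  haveI : CompactSpace (galoisGroupAbove S H) := compactSpace_galoisGroupAbove S H hH
  let θ : H →ₜ* galoisGroupAbove S H :=
    { toFun := fun σ => ⟨toUnramifiedQuot K S (σ : absoluteGaloisGroup K), coe_mem_galoisGroupAbove S H σ⟩
      map_one' := Subtype.ext (by simp)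
      map_mul' := fun a b => galoisGroupAbove_mk_mul S H a b
      continuous_toFun := ((continuous_toUnramifiedQuot K S).comp continuous_subtype_val).subtype_mk _ }
  have hθ : ∀ σ : H, θ σ = ⟨toUnramifiedQuot K S (σ : absoluteGaloisGroup K), coe_mem_galoisGroupAbove S H σ⟩ :=
    fun _ => rfl
  have hq : IsQuotientMap θ :=
    θ.continuous_toFun.isClosedMap.isQuotientMap θ.continuous_toFun (galoisGroupAbove_mk_surjective S H)
  have hθN : ∀ {n : H}, θ n = 1 ↔ (n : absoluteGaloisGroup K) ∈ ramificationSubgroup K S := fun {n} =>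
    galoisGroupAbove_mk_eq_one_iff S H n
  have hφ' : ∀ σ τ : H, f.1 (θ σ, θ τ) = ρG.toTopRep.ρ (θ σ) (φ τ) - φ (σ * τ) + φ σ := fun σ τ => by
    rw [ContinuousRep.toTopRep_ρ_apply, hθ, hρG]
    exact hφ σ τ
  -- `δ := β / d`, an `N'`-th root of `c`
  set δ : (AlgebraicClosure K)ˣ := β / d with hδ
  have hδN' : δ ^ N' = c := by
    have h1 : β ^ N' = (β ^ N) ^ e := by rw [← pow_mul, hNe]
    rw [hδ, div_pow, h1, hbe, mul_div_cancel_right]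
  clear_value δ
  -- the Kummer cocycle `ψ(σ) = σ(δ)/δ` of `H` in `μ_{N'}`
  have hψpow : ∀ σ : H, ((σ : absoluteGaloisGroup K) • δ / δ) ^ N' = 1 := fun σ => by
    rw [div_pow, ← smul_pow', hδN', hc σ σ.2, div_self']
  have hψlc : IsLocallyConstant fun σ : H =>
      muOfUnit K N' ((σ : absoluteGaloisGroup K) • δ / δ) (hψpow σ) := by
    refine IsLocallyConstant.desc _ (muVal K N') ?_ (muVal_injective K N')
    have h1 : (muVal K N' ∘ fun σ : H => muOfUnit K N' ((σ : absoluteGaloisGroup K) • δ / δ) (hψpow σ)) =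
        (fun σ : absoluteGaloisGroup K => σ • δ / δ) ∘ (Subtype.val : H → absoluteGaloisGroup K) := by
      funext σ
      rfl
    rw [h1]
    exact ((isLocallyConstant_smul_units K δ).div (IsLocallyConstant.const _)).comp_continuous
      continuous_subtype_val
  let ψ : C(H, MuCarrier K N') :=
    ⟨fun σ => muOfUnit K N' ((σ : absoluteGaloisGroup K) • δ / δ) (hψpow σ), hψlc.continuous⟩
  have hψval : ∀ σ : H, muVal K N' (ψ σ) = (σ : absoluteGaloisGroup K) • δ / δ := fun σ => rfl
  have hψ : ∀ σ τ : H, ψ (σ * τ) = ψ σ + ρG'.toTopRep.ρ (θ σ) (ψ τ) := fun σ τ => by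
    apply muVal_injective K N'
    rw [ContinuousRep.toTopRep_ρ_apply, hθ, hρG', muVal_add, muVal_apply, hψval, hψval, hψval,
      Subgroup.coe_mul, mul_smul, smul_div' (σ : absoluteGaloisGroup K) ((τ : absoluteGaloisGroup K) • δ) δ,
      mul_comm, div_mul_div_cancel]
  have hψN : ∀ n : H, θ n = 1 → ψ n = J.hom (φ n - f.1 (1, 1)) := fun n hn => by
    have hn' : (n : absoluteGaloisGroup K) ∈ ramificationSubgroup K S := hθN.1 hn
    apply muVal_injective K N'
    rw [hJ, muVal_muInclusion, hψval, hβ _ hn', hδ, smul_div', hd _ hn', div_div_div_cancel_right]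
  exact cohomologyMap_twoCocycleClass_eq_zero_of_oneCocycle_extension θ hq J f φ hφ' ψ hψ hψN

/-- **Cochain form, self-contained coefficients**: with `N_S` fixing `μ_{N'}`, a Kummer generator `β`
and a factorisation `(β^N)^e = c·d^{N'}` give a continuous `b : Gal(K_S/F) → μ_{N'}` with
`ι(f(q σ, q τ)) = σ·b(q τ) − b(q(στ)) + b(q σ)` (`σ, τ ∈ H`).
[cite: NeukirchSchmidtWingberg2008, (1.6.7), (8.3.11) (ii)] [cite: Serre1979, Ch. X §3 b)] -/
theorem exists_twoCoboundary_of_kummerGenerator'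
    (hH : IsClosed (H : Set (absoluteGaloisGroup K))) (hNH : ramificationSubgroup K S ≤ H)
    {N N' e : ℕ} (hNe : N * e = N')
    (htriv' : ∀ n ∈ ramificationSubgroup K S, ∀ v : MuCarrier K N', mu K N' n v = v)
    (ρG : ContinuousRep (galoisGroupAbove S H) ℤ (MuCarrier K N))
    (hρG : ∀ (σ : H) (v : MuCarrier K N),
      ρG ⟨toUnramifiedQuot K S (σ : absoluteGaloisGroup K), coe_mem_galoisGroupAbove S H σ⟩ v =
        mu K N (σ : absoluteGaloisGroup K) v)
    (f : contTwoCocycles ρG.toTopRep) (φ : C(H, MuCarrier K N))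
    (hφ : ∀ σ τ : H,
      f.1 (⟨toUnramifiedQuot K S (σ : absoluteGaloisGroup K), coe_mem_galoisGroupAbove S H σ⟩,
          ⟨toUnramifiedQuot K S (τ : absoluteGaloisGroup K), coe_mem_galoisGroupAbove S H τ⟩) =
        mu K N (σ : absoluteGaloisGroup K) (φ τ) - φ (σ * τ) + φ σ)
    (β : (AlgebraicClosure K)ˣ)
    (hβ : ∀ (n : absoluteGaloisGroup K) (hn : n ∈ ramificationSubgroup K S),
      muVal K N (φ ⟨n, hNH hn⟩ - f.1 (1, 1)) = n • β / β)
    (c d : (AlgebraicClosure K)ˣ) (hc : ∀ σ ∈ H, σ • c = c) (hd : ∀ n ∈ ramificationSubgroup K S, n • d = d)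
    (hbe : (β ^ N) ^ e = c * d ^ N') :
    ∃ b : C(galoisGroupAbove S H, MuCarrier K N'), ∀ σ τ : H,
      muInclusion K ⟨e, hNe.symm⟩
          (f.1 (⟨toUnramifiedQuot K S (σ : absoluteGaloisGroup K), coe_mem_galoisGroupAbove S H σ⟩,
            ⟨toUnramifiedQuot K S (τ : absoluteGaloisGroup K), coe_mem_galoisGroupAbove S H τ⟩)) =
        mu K N' (σ : absoluteGaloisGroup K)
            (b ⟨toUnramifiedQuot K S (τ : absoluteGaloisGroup K), coe_mem_galoisGroupAbove S H τ⟩) -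
          b ⟨toUnramifiedQuot K S ((σ * τ : H) : absoluteGaloisGroup K), coe_mem_galoisGroupAbove S H (σ * τ)⟩ +
          b ⟨toUnramifiedQuot K S (σ : absoluteGaloisGroup K), coe_mem_galoisGroupAbove S H σ⟩ := by
  haveI : CompactSpace (galoisGroupAbove S H) := compactSpace_galoisGroupAbove S H hH
  -- the descended action on `μ_{N'}` and `J : μ_N → μ_{N'}` over `Gal(K_S/F)`
  obtain ⟨ρ₀', -, hρG'⟩ := exists_continuousRep_galoisGroupAbove_mu S H (N := N') htriv'
  set ρG' := ρ₀'.restrict (subgroupIncl (galoisGroupAbove S H)) with hρG'def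
  let J : ρG.toTopRep ⟶ ρG'.toTopRep :=
    TopRep.ofHom ⟨⟨(muInclusion K ⟨e, hNe.symm⟩).toIntLinearMap, continuous_of_discreteTopology⟩, fun g => by
      ext v
      obtain ⟨σ, rfl⟩ := galoisGroupAbove_mk_surjective S H g
      apply muVal_injective K N'
      change muVal K N' (muInclusion K ⟨e, hNe.symm⟩ (ρG _ v)) = muVal K N' (ρG' _ (muInclusion K ⟨e, hNe.symm⟩ v))
      rw [hρG, hρG', muVal_muInclusion, muVal_apply, muVal_apply, muVal_muInclusion]⟩
  have h0 := cohomologyMap_twoCocycleClass_eq_zero_of_kummerGenerator S H hH hNH hNe ρG hρG ρG' hρG' J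
    (fun _ => rfl) f φ hφ β hβ c d hc hd hbe
  rw [cohomologyMap_twoCocycleClass, twoCocycleClass_eq_zero_iff] at h0
  obtain ⟨b, hb⟩ := h0
  refine ⟨b, fun σ τ => ?_⟩
  have h := hb ⟨toUnramifiedQuot K S (σ : absoluteGaloisGroup K), coe_mem_galoisGroupAbove S H σ⟩
    ⟨toUnramifiedQuot K S (τ : absoluteGaloisGroup K), coe_mem_galoisGroupAbove S H τ⟩
  rw [pullback₂_id_resIdHom_apply, ContinuousRep.toTopRep_ρ_apply, hρG', ← galoisGroupAbove_mk_mul] at h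
  exact h

/-! ### §3. The consumer-ready `p`-power form -/

/-- **`ker(inf²)` dies under `μ_{p^a} ↪ μ_{p^{a+t}}` — `p`-power form with (KUM) and «`N_S` fixes
`μ_{p^∞}`» discharged.**  `K` a number field, `S ⊇ {v ∣ p}`, `H ≤ Γ_K` closed with `N_S ≤ H`
(`F = K̄^H ⊆ K_S`), `ρG` a descended action of `Gal(K_S/F)` on `μ_{p^a}`, `f` a continuous `2`-cocycle
of `Gal(K_S/F)` in `μ_{p^a}` with `f ∘ (q × q) = ∂φ` on `H`.  ASSUME (RD), radical descent for `F`
inside `K_S`, in the element form: every `b ∈ K_S` (`N_S`-fixed), `b ≠ 0`, with `σ(b) ∈ b · (K_S)^{p^a}`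
for all `σ ∈ H` satisfies `b^{p^t} = c · d^{p^{a+t}}` for some `t`, some `c ∈ F^×` and some `d ∈ K_S`
(for `H` open: `F` a number field, `p^t ≥` the exponent of the `p`-part of its class group; NSW
(8.3.11) (ii) via Kummer theory).  THEN there are `t` and a continuous `b : Gal(K_S/F) → μ_{p^{a+t}}` with
`ι(f(q σ, q τ)) = σ·b(q τ) − b(q(στ)) + b(q σ)` for all `σ, τ ∈ H`.
[cite: NeukirchSchmidtWingberg2008, (8.3.11) (ii), (10.3.25)] [cite: Serre1979, Ch. X §3 b)] -/
theorem exists_twoCoboundary_of_radicalDescent_primePow {p : ℕ} [Fact p.Prime]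
    (hS : ∀ v : HeightOneSpectrum (𝓞 K), ((p : ℕ) : 𝓞 K) ∈ v.asIdeal → v ∈ S)
    (hH : IsClosed (H : Set (absoluteGaloisGroup K))) (hNH : ramificationSubgroup K S ≤ H) {a : ℕ}
    (hRD : ∀ b : AlgebraicClosure K, b ≠ 0 → (∀ n ∈ ramificationSubgroup K S, n • b = b) →
      (∀ σ ∈ H, ∃ d : AlgebraicClosure K,
        (∀ n ∈ ramificationSubgroup K S, n • d = d) ∧ σ • b = b * d ^ p ^ a) →
      ∃ t : ℕ, ∃ c : AlgebraicClosure K, c ≠ 0 ∧ (∀ σ ∈ H, σ • c = c) ∧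
        ∃ d : AlgebraicClosure K, (∀ n ∈ ramificationSubgroup K S, n • d = d) ∧
          b ^ p ^ t = c * d ^ p ^ (a + t))
    (ρG : ContinuousRep (galoisGroupAbove S H) ℤ (MuCarrier K (p ^ a)))
    (hρG : ∀ (σ : H) (v : MuCarrier K (p ^ a)),
      ρG ⟨toUnramifiedQuot K S (σ : absoluteGaloisGroup K), coe_mem_galoisGroupAbove S H σ⟩ v =
        mu K (p ^ a) (σ : absoluteGaloisGroup K) v)
    (f : contTwoCocycles ρG.toTopRep) (φ : C(H, MuCarrier K (p ^ a)))
    (hφ : ∀ σ τ : H,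
      f.1 (⟨toUnramifiedQuot K S (σ : absoluteGaloisGroup K), coe_mem_galoisGroupAbove S H σ⟩,
          ⟨toUnramifiedQuot K S (τ : absoluteGaloisGroup K), coe_mem_galoisGroupAbove S H τ⟩) =
        mu K (p ^ a) (σ : absoluteGaloisGroup K) (φ τ) - φ (σ * τ) + φ σ) :
    ∃ (t : ℕ) (b : C(galoisGroupAbove S H, MuCarrier K (p ^ (a + t)))), ∀ σ τ : H,
      muInclusion K (pow_dvd_pow p (Nat.le_add_right a t))
          (f.1 (⟨toUnramifiedQuot K S (σ : absoluteGaloisGroup K), coe_mem_galoisGroupAbove S H σ⟩,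
            ⟨toUnramifiedQuot K S (τ : absoluteGaloisGroup K), coe_mem_galoisGroupAbove S H τ⟩)) =
        mu K (p ^ (a + t)) (σ : absoluteGaloisGroup K)
            (b ⟨toUnramifiedQuot K S (τ : absoluteGaloisGroup K), coe_mem_galoisGroupAbove S H τ⟩) -
          b ⟨toUnramifiedQuot K S ((σ * τ : H) : absoluteGaloisGroup K), coe_mem_galoisGroupAbove S H (σ * τ)⟩ +
          b ⟨toUnramifiedQuot K S (σ : absoluteGaloisGroup K), coe_mem_galoisGroupAbove S H σ⟩ := by
  have hp : p.Prime := Fact.out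
  haveI : NeZero (p ^ a) := ⟨pow_ne_zero _ hp.ne_zero⟩
  -- §1: the Kummer generator
  obtain ⟨β, hβ, hbN, hbH⟩ := exists_transgression_kummerGenerator_of_numberField S H hNH ρG hρG f φ hφ
  -- (RD) applied to `b₀ = β ^ p ^ a ∈ K_S`
  have hbN₀ : ∀ n ∈ ramificationSubgroup K S, n • ((β ^ p ^ a : (AlgebraicClosure K)ˣ) : AlgebraicClosure K) =
      ((β ^ p ^ a : (AlgebraicClosure K)ˣ) : AlgebraicClosure K) := fun n hn => by
    rw [← Units.coe_smul, hbN n hn]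
  have hbH₀ : ∀ σ ∈ H, ∃ d : AlgebraicClosure K, (∀ n ∈ ramificationSubgroup K S, n • d = d) ∧
      σ • ((β ^ p ^ a : (AlgebraicClosure K)ˣ) : AlgebraicClosure K) =
        ((β ^ p ^ a : (AlgebraicClosure K)ˣ) : AlgebraicClosure K) * d ^ p ^ a := fun σ hσ => by
    obtain ⟨d, hd, hσb⟩ := hbH σ hσ
    refine ⟨(d : AlgebraicClosure K), fun n hn => by rw [← Units.coe_smul, hd n hn], ?_⟩
    rw [← Units.coe_smul, hσb, Units.val_mul, Units.val_pow_eq_pow_val, Units.val_pow_eq_pow_val]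
  obtain ⟨t, c, hc0, hc, d, hd, hbe⟩ := hRD _ (β ^ p ^ a).ne_zero hbN₀ hbH₀
  -- `d ≠ 0`, and everything as units
  have hd0 : d ≠ 0 := by
    rintro rfl
    rw [zero_pow (pow_ne_zero _ hp.ne_zero), mul_zero] at hbe
    exact pow_ne_zero _ (β ^ p ^ a).ne_zero hbe
  have hc' : ∀ σ ∈ H, σ • Units.mk0 c hc0 = Units.mk0 c hc0 := fun σ hσ =>
    Units.ext (by rw [Units.coe_smul, Units.val_mk0, hc σ hσ])
  have hd' : ∀ n ∈ ramificationSubgroup K S, n • Units.mk0 d hd0 = Units.mk0 d hd0 := fun n hn =>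
    Units.ext (by rw [Units.coe_smul, Units.val_mk0, hd n hn])
  have hbe' : (β ^ p ^ a) ^ p ^ t = Units.mk0 c hc0 * Units.mk0 d hd0 ^ p ^ (a + t) :=
    Units.ext (by
      simp only [Units.val_pow_eq_pow_val, Units.val_mul, Units.val_mk0]
      rw [← Units.val_pow_eq_pow_val]
      exact hbe)
  -- `N_S` fixes `μ_{p^{a+t}}` (`S ⊇ {v ∣ p}`)
  have hS' : ∀ v : HeightOneSpectrum (𝓞 K), ((p ^ (a + t) : ℕ) : 𝓞 K) ∈ v.asIdeal → v ∈ S := fun v hv => by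
    rw [Nat.cast_pow] at hv
    exact hS v (v.isPrime.mem_of_pow_mem _ hv)
  have htriv' : ∀ n ∈ ramificationSubgroup K S, ∀ v : MuCarrier K (p ^ (a + t)), mu K (p ^ (a + t)) n v = v := by
    intro n hn v
    apply muVal_injective K (p ^ (a + t))
    rw [muVal_apply]
    refine Units.ext ?_
    rw [Units.coe_smul]
    exact smul_units_eq_self_of_mem_ramificationSubgroup hS' _ (muVal_pow_eq_one K _ v) n hn
  -- §2
  obtain ⟨b, hb⟩ := exists_twoCoboundary_of_kummerGenerator' S H hH hNH ((pow_add p a t).symm) htriv' ρG hρG f φ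
    hφ β hβ (Units.mk0 c hc0) (Units.mk0 d hd0) hc' hd' hbe'
  exact ⟨t, b, hb⟩

end Literature.NumberTheory.GaloisRepresentations

end
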